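import Summits.Parity.GeneralizedHardyLittlewood.Theorems.GreenTaoLevelTwoMNTwoQuarticStructure
import Summits.Parity.GeneralizedHardyLittlewood.Theorems.GreenTaoLevelTwoMNTwoPropNineteenGlue

/-!
# Route `GreenTaoLevelTwo`, crux `MNTwo` (stmt-Parity-21276), line `birth`, stub `stub_mnVertical`:
# the sixteen phases of Lemma 24 combine to `e(2θ l₁l₂m₁m₂)` (GT 2008b §10, via Lemma 21)

Block V4 / H3 (= AIF §10 Lemma 24 "Type II sum implies major arc", the step "The sixteen phases
`e(φ(P(l,m)))` combine to form a single phase … The presence of the fourty-eight cutoffs is just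
what we need to apply Lemma 21, which allows us write the phase as `e(2l₁l₂m₁m₂φ''(st,st))`") of the
`stub_mnVertical` census (B. Green, T. Tao, *Quadratic uniformity of the Möbius function*, Ann.
Inst. Fourier 58 (2008) = arXiv:math/0606087, §10).  Def-free glue between
`…MNTwoTypeIISecondCS.second_cs_pigeonhole` (whose sixteenfold product, for the unit phases
`u(l,m) = toCircle(φ(P(l,m)))`, is the left-hand side below, in the same nesting) and
`…MNTwoQuarticStructure.quartic_structure` (Lemma 21), for `φ : ℤ → ℝ/ℤ` and a real lift `θ` of
`φ''(st,st)`; the output phase `e(2θ·l₁l₂m₁m₂)` is the kernel of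
`…MNTwoBoxPhase.norm_pow_sixteen_quadrilinear_le` with `c = 2θ`.

* `sixteen_phase_eq` — the sixteenfold alternating product of the `u(P(·,·))` equals
  `e(2θ l₁l₂m₁m₂)` under the five memberships of Lemma 21.

References: [GreenTao2008QuadraticMobius] arXiv:math/0606087 §10 (proof of Lemma 24), Lemma 21.
-/

noncomputable section

open scoped ComplexConjugate FourierTransform

namespace Summit.Parity.GeneralizedHardyLittlewood.GreenTaoLevelTwoMNTwoSixteenPhase

open Summit.Parity.GeneralizedHardyLittlewood.GreenTaoLevelTwoMNTwoQuarticStructure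
  (quartic_structure)
open Summit.Parity.GeneralizedHardyLittlewood.GreenTaoLevelTwoMNTwoPropNineteenGlue
  (toCircle_coe_eq_fourierChar)

/-- **The sixteen phases combine (GT 2008b §10 via Lemma 21).**  Let `ν` be a symmetric subadditive
gauge, `φ : ℤ → ℝ/ℤ` locally quadratic on `B(n₀,R)`, `13ρ ≤ R`, `1 ≤ L, M`, `L·M·ν(st) ≤ ρ`,
`|l₁|,|l₂| ≤ L`, `|m₁|,|m₂| ≤ M`, the five Lemma-21 memberships, `u(l,m) = toCircle(φ((d+sl)(w+tm)))`
and `θ ∈ ℝ` a lift of `φ''(st,st)`.  Then the sixteenfold alternating product of `u` over the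
parallelepiped (nesting of `…MNTwoTypeIISecondCS.second_cs_pigeonhole`) equals `e(2θ l₁l₂m₁m₂)`.
[cite: GreenTao2008QuadraticMobius, §10 (proof of Lemma 24) and Lemma 21] -/
theorem sixteen_phase_eq (ν : ℤ → ℝ) (hν0 : ν 0 = 0) (hνnn : ∀ x, 0 ≤ ν x)
    (hνneg : ∀ x, ν (-x) = ν x) (hνadd : ∀ x y, ν (x + y) ≤ ν x + ν y)
    (φ : ℤ → UnitAddCircle) {n₀ : ℤ} {R ρ : ℝ}
    (hφ : ∀ n a b c : ℤ, ν (n - n₀) < R → ν (n + a - n₀) < R → ν (n + b - n₀) < R →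
      ν (n + c - n₀) < R → ν (n + a + b - n₀) < R → ν (n + a + c - n₀) < R →
      ν (n + b + c - n₀) < R → ν (n + a + b + c - n₀) < R →
      φ (n + a + b + c) - φ (n + a + b) - φ (n + a + c) - φ (n + b + c)
        + φ (n + a) + φ (n + b) + φ (n + c) - φ n = 0)
    (hR : 13 * ρ ≤ R) (d w s t : ℤ) {L M : ℕ} (hL : 1 ≤ L) (hM : 1 ≤ M)
    (hst : (L : ℝ) * M * ν (s * t) ≤ ρ) (l₀ l₁ l₂ m₀ m₁ m₂ : ℤ)
    (hl₁ : |l₁| ≤ L) (hl₂ : |l₂| ≤ L) (hm₁ : |m₁| ≤ M) (hm₂ : |m₂| ≤ M)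
    (h00 : ν ((d + s * l₀) * (w + t * m₀) - n₀) < ρ)
    (h10 : ν ((d + s * (l₀ + l₁)) * (w + t * m₀) - n₀) < ρ)
    (h20 : ν ((d + s * (l₀ + l₂)) * (w + t * m₀) - n₀) < ρ)
    (h01 : ν ((d + s * l₀) * (w + t * (m₀ + m₁)) - n₀) < ρ)
    (h02 : ν ((d + s * l₀) * (w + t * (m₀ + m₂)) - n₀) < ρ)
    (u : ℤ → ℤ → ℂ) (hu : ∀ l m, u l m = (AddCircle.toCircle (φ ((d + s * l) * (w + t * m))) : ℂ))
    (θ : ℝ) (hθ : ((θ : ℝ) : UnitAddCircle) =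
      φ (n₀ + s * t + s * t) - φ (n₀ + s * t) - φ (n₀ + s * t) + φ n₀) :
    (u l₀ m₀ * conj (u l₀ (m₀ + m₁)) * conj (u (l₀ + l₁) m₀) * u (l₀ + l₁) (m₀ + m₁)) *
      conj (u l₀ (m₀ + m₂) * conj (u l₀ (m₀ + m₂ + m₁)) * conj (u (l₀ + l₁) (m₀ + m₂)) *
        u (l₀ + l₁) (m₀ + m₂ + m₁)) *
      conj (u (l₀ + l₂) m₀ * conj (u (l₀ + l₂) (m₀ + m₁)) * conj (u (l₀ + l₂ + l₁) m₀) *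
        u (l₀ + l₂ + l₁) (m₀ + m₁)) *
      (u (l₀ + l₂) (m₀ + m₂) * conj (u (l₀ + l₂) (m₀ + m₂ + m₁)) *
        conj (u (l₀ + l₂ + l₁) (m₀ + m₂)) * u (l₀ + l₂ + l₁) (m₀ + m₂ + m₁)) =
      (𝐞 (2 * θ * l₁ * l₂ * m₁ * m₂) : ℂ) := by
  -- `conj toCircle x = toCircle (−x)`, `toCircle x · toCircle y = toCircle (x + y)`
  have hc : ∀ x : UnitAddCircle, conj ((AddCircle.toCircle x : ℂ)) =
      (AddCircle.toCircle (-x) : ℂ) := fun x => by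
    rw [AddCircle.toCircle_neg, Circle.coe_inv_eq_conj]
  have hm : ∀ x y : UnitAddCircle, (AddCircle.toCircle x : ℂ) * (AddCircle.toCircle y : ℂ) =
      (AddCircle.toCircle (x + y) : ℂ) := fun x y => by
    rw [AddCircle.toCircle_add, Circle.coe_mul]
  simp only [hu, hc, hm, neg_add_rev, neg_neg]
  -- align the integer arguments with Lemma 21
  rw [show l₀ + l₂ + l₁ = l₀ + l₁ + l₂ by ring, show m₀ + m₂ + m₁ = m₀ + m₁ + m₂ by ring]
  have key := quartic_structure ν hν0 hνnn hνneg hνadd φ hφ hR d w s t hL hM hst l₀ l₁ l₂ m₀ m₁ m₂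
    hl₁ hl₂ hm₁ hm₂ h00 h10 h20 h01 h02
  -- the right-hand side as `toCircle` of an integer multiple of `θ`
  have hz : (((2 * θ * l₁ * l₂ * m₁ * m₂ : ℝ)) : UnitAddCircle) =
      (2 * l₁ * l₂ * m₁ * m₂ : ℤ) • ((θ : ℝ) : UnitAddCircle) := by
    rw [← AddCircle.coe_zsmul]
    congr 1
    ring
  rw [← toCircle_coe_eq_fourierChar, hz, hθ, ← key]
  congr 2
  abel

/-- **Each term of the sixteenfold sum = (product of the sixteen real cutoffs) × `e(2θ l₁l₂m₁m₂)`.**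
Hypotheses as in `…MNTwoSixteenPhase.sixteen_phase_eq`, except that the five memberships are
replaced by the support property of the real cutoff `wt` (`wt(l,m) ≠ 0 ⇒ P(l,m) ∈ B(n₀,ρ)`), and
`f(l,m) = wt(l,m)·u(l,m)`. [cite: GreenTao2008QuadraticMobius, §10 (proof of Lemma 24)] -/
theorem sixteen_term_eq (ν : ℤ → ℝ) (hν0 : ν 0 = 0) (hνnn : ∀ x, 0 ≤ ν x)
    (hνneg : ∀ x, ν (-x) = ν x) (hνadd : ∀ x y, ν (x + y) ≤ ν x + ν y)
    (φ : ℤ → UnitAddCircle) {n₀ : ℤ} {R ρ : ℝ}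
    (hφ : ∀ n a b c : ℤ, ν (n - n₀) < R → ν (n + a - n₀) < R → ν (n + b - n₀) < R →
      ν (n + c - n₀) < R → ν (n + a + b - n₀) < R → ν (n + a + c - n₀) < R →
      ν (n + b + c - n₀) < R → ν (n + a + b + c - n₀) < R →
      φ (n + a + b + c) - φ (n + a + b) - φ (n + a + c) - φ (n + b + c)
        + φ (n + a) + φ (n + b) + φ (n + c) - φ n = 0)
    (hR : 13 * ρ ≤ R) (d w s t : ℤ) {L M : ℕ} (hL : 1 ≤ L) (hM : 1 ≤ M)
    (hst : (L : ℝ) * M * ν (s * t) ≤ ρ) (l₀ l₁ l₂ m₀ m₁ m₂ : ℤ)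
    (hl₁ : |l₁| ≤ L) (hl₂ : |l₂| ≤ L) (hm₁ : |m₁| ≤ M) (hm₂ : |m₂| ≤ M)
    (wt : ℤ → ℤ → ℝ) (hwt : ∀ l m, wt l m ≠ 0 → ν ((d + s * l) * (w + t * m) - n₀) < ρ)
    (u : ℤ → ℤ → ℂ) (hu : ∀ l m, u l m = (AddCircle.toCircle (φ ((d + s * l) * (w + t * m))) : ℂ))
    (f : ℤ → ℤ → ℂ) (hf : ∀ l m, f l m = (wt l m : ℂ) * u l m)
    (θ : ℝ) (hθ : ((θ : ℝ) : UnitAddCircle) =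
      φ (n₀ + s * t + s * t) - φ (n₀ + s * t) - φ (n₀ + s * t) + φ n₀) :
    (f l₀ m₀ * conj (f l₀ (m₀ + m₁)) * conj (f (l₀ + l₁) m₀) * f (l₀ + l₁) (m₀ + m₁)) *
      conj (f l₀ (m₀ + m₂) * conj (f l₀ (m₀ + m₂ + m₁)) * conj (f (l₀ + l₁) (m₀ + m₂)) *
        f (l₀ + l₁) (m₀ + m₂ + m₁)) *
      conj (f (l₀ + l₂) m₀ * conj (f (l₀ + l₂) (m₀ + m₁)) * conj (f (l₀ + l₂ + l₁) m₀) *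
        f (l₀ + l₂ + l₁) (m₀ + m₁)) *
      (f (l₀ + l₂) (m₀ + m₂) * conj (f (l₀ + l₂) (m₀ + m₂ + m₁)) *
        conj (f (l₀ + l₂ + l₁) (m₀ + m₂)) * f (l₀ + l₂ + l₁) (m₀ + m₂ + m₁)) =
      (((wt l₀ m₀ * wt l₀ (m₀ + m₁) * wt (l₀ + l₁) m₀ * wt (l₀ + l₁) (m₀ + m₁)) *
        (wt l₀ (m₀ + m₂) * wt l₀ (m₀ + m₂ + m₁) * wt (l₀ + l₁) (m₀ + m₂) *
          wt (l₀ + l₁) (m₀ + m₂ + m₁)) *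
        (wt (l₀ + l₂) m₀ * wt (l₀ + l₂) (m₀ + m₁) * wt (l₀ + l₂ + l₁) m₀ *
          wt (l₀ + l₂ + l₁) (m₀ + m₁)) *
        (wt (l₀ + l₂) (m₀ + m₂) * wt (l₀ + l₂) (m₀ + m₂ + m₁) * wt (l₀ + l₂ + l₁) (m₀ + m₂) *
          wt (l₀ + l₂ + l₁) (m₀ + m₂ + m₁)) : ℝ) : ℂ) *
      (𝐞 (2 * θ * l₁ * l₂ * m₁ * m₂) : ℂ) := by
  -- split every `f` into its real cutoff and its unit phase
  have split :
      (f l₀ m₀ * conj (f l₀ (m₀ + m₁)) * conj (f (l₀ + l₁) m₀) * f (l₀ + l₁) (m₀ + m₁)) *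
      conj (f l₀ (m₀ + m₂) * conj (f l₀ (m₀ + m₂ + m₁)) * conj (f (l₀ + l₁) (m₀ + m₂)) *
        f (l₀ + l₁) (m₀ + m₂ + m₁)) *
      conj (f (l₀ + l₂) m₀ * conj (f (l₀ + l₂) (m₀ + m₁)) * conj (f (l₀ + l₂ + l₁) m₀) *
        f (l₀ + l₂ + l₁) (m₀ + m₁)) *
      (f (l₀ + l₂) (m₀ + m₂) * conj (f (l₀ + l₂) (m₀ + m₂ + m₁)) *
        conj (f (l₀ + l₂ + l₁) (m₀ + m₂)) * f (l₀ + l₂ + l₁) (m₀ + m₂ + m₁)) =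
      (((wt l₀ m₀ * wt l₀ (m₀ + m₁) * wt (l₀ + l₁) m₀ * wt (l₀ + l₁) (m₀ + m₁)) *
        (wt l₀ (m₀ + m₂) * wt l₀ (m₀ + m₂ + m₁) * wt (l₀ + l₁) (m₀ + m₂) *
          wt (l₀ + l₁) (m₀ + m₂ + m₁)) *
        (wt (l₀ + l₂) m₀ * wt (l₀ + l₂) (m₀ + m₁) * wt (l₀ + l₂ + l₁) m₀ *
          wt (l₀ + l₂ + l₁) (m₀ + m₁)) *
        (wt (l₀ + l₂) (m₀ + m₂) * wt (l₀ + l₂) (m₀ + m₂ + m₁) * wt (l₀ + l₂ + l₁) (m₀ + m₂) *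
          wt (l₀ + l₂ + l₁) (m₀ + m₂ + m₁)) : ℝ) : ℂ) *
      ((u l₀ m₀ * conj (u l₀ (m₀ + m₁)) * conj (u (l₀ + l₁) m₀) * u (l₀ + l₁) (m₀ + m₁)) *
        conj (u l₀ (m₀ + m₂) * conj (u l₀ (m₀ + m₂ + m₁)) * conj (u (l₀ + l₁) (m₀ + m₂)) *
          u (l₀ + l₁) (m₀ + m₂ + m₁)) *
        conj (u (l₀ + l₂) m₀ * conj (u (l₀ + l₂) (m₀ + m₁)) * conj (u (l₀ + l₂ + l₁) m₀) *
          u (l₀ + l₂ + l₁) (m₀ + m₁)) *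
        (u (l₀ + l₂) (m₀ + m₂) * conj (u (l₀ + l₂) (m₀ + m₂ + m₁)) *
          conj (u (l₀ + l₂ + l₁) (m₀ + m₂)) * u (l₀ + l₂ + l₁) (m₀ + m₂ + m₁))) := by
    simp only [hf, map_mul, Complex.conj_ofReal]
    push_cast
    ring
  rw [split]
  by_cases hW : (wt l₀ m₀ * wt l₀ (m₀ + m₁) * wt (l₀ + l₁) m₀ * wt (l₀ + l₁) (m₀ + m₁)) *
        (wt l₀ (m₀ + m₂) * wt l₀ (m₀ + m₂ + m₁) * wt (l₀ + l₁) (m₀ + m₂) *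
          wt (l₀ + l₁) (m₀ + m₂ + m₁)) *
        (wt (l₀ + l₂) m₀ * wt (l₀ + l₂) (m₀ + m₁) * wt (l₀ + l₂ + l₁) m₀ *
          wt (l₀ + l₂ + l₁) (m₀ + m₁)) *
        (wt (l₀ + l₂) (m₀ + m₂) * wt (l₀ + l₂) (m₀ + m₂ + m₁) * wt (l₀ + l₂ + l₁) (m₀ + m₂) *
          wt (l₀ + l₂ + l₁) (m₀ + m₂ + m₁)) = 0
  · rw [hW]; simp
  · -- all sixteen cutoffs are non-zero; in particular the five needed by Lemma 21
    have h00 : wt l₀ m₀ ≠ 0 := fun h0 => hW (by rw [h0]; ring)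
    have h10 : wt (l₀ + l₁) m₀ ≠ 0 := fun h0 => hW (by rw [h0]; ring)
    have h20 : wt (l₀ + l₂) m₀ ≠ 0 := fun h0 => hW (by rw [h0]; ring)
    have h01 : wt l₀ (m₀ + m₁) ≠ 0 := fun h0 => hW (by rw [h0]; ring)
    have h02 : wt l₀ (m₀ + m₂) ≠ 0 := fun h0 => hW (by rw [h0]; ring)
    rw [sixteen_phase_eq ν hν0 hνnn hνneg hνadd φ hφ hR d w s t hL hM hst l₀ l₁ l₂ m₀ m₁ m₂
      hl₁ hl₂ hm₁ hm₂ (hwt _ _ h00) (hwt _ _ h10) (hwt _ _ h20) (hwt _ _ h01) (hwt _ _ h02)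
      u hu θ hθ]

end Summit.Parity.GeneralizedHardyLittlewood.GreenTaoLevelTwoMNTwoSixteenPhase
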